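import Mathlib
import Summits.Ventures.PercRepro2.Defs
import Summits.Ventures.PercRepro2.Graph
import Summits.Ventures.PercRepro2.OneColourSwitch
import Summits.Ventures.PercRepro2.RegionHubSign
import Summits.Ventures.PercRepro2.SideSwitch
import Summits.Ventures.PercRepro2.SideSwitchFibre
import Summits.Ventures.PercRepro2.SideSwitchMono
import Summits.Ventures.PercRepro2.SideSwitchM9
import Summits.Ventures.PercRepro2.SideSwitchClosed
import Summits.Ventures.PercRepro2.SideSwitchComps
import Summits.Ventures.PercRepro2.SideSwitchCompsFibre
import Summits.Ventures.PercRepro2.M9LatticeHarrisGen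
import Summits.Ventures.PercRepro2.M9LatticeHarrisSub
import Summits.Ventures.PercRepro2.M9NoPocketDefs
import Summits.Ventures.PercRepro2.M9NoPocketHarris
import Summits.Ventures.PercRepro2.M9NoPocketSetDefs
import Summits.Ventures.PercRepro2.M9NoPocketSetWorld
import Summits.Ventures.PercRepro2.M9NoPocketSetWorldD
import Summits.Ventures.PercRepro2.M9NoPocketSetLegal
import Summits.Ventures.PercRepro2.M9NoPocketSetFibre
import Summits.Ventures.PercRepro2.M9NoPocketSetMono
import Summits.Ventures.PercRepro2.M9NoPocketSetCompl
import Summits.Ventures.PercRepro2.M9NoPocketSetFlipRS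
import Summits.Ventures.PercRepro2.M9NoPocketSetCompl2
import Summits.Ventures.PercRepro2.M9NoPocketSetHarris

/-!
# `m9` on the multi-`d` class without pockets — the theorem (blind cell PercRepro2, p3 g20,
2026-08-27; `proofs/P3-CPNC.md` §17i (2))

For a finite marked multigraph and a set `D` of pairwise non-adjacent non-marks each of whose
neighbours (other than `r, s`) is adjacent to `r` or `s`: `Σ_{ω ∈ Sep, D(ω) ⊆ D} σ_pq · σ_rs ≤ 0`
(`dSignSum_nonpos_of_noPocketSet`), and `m9 ≤ 0` when moreover every non-mark outside `D` is
adjacent to `p` or `q` (`m9SignSum_nonpos_of_multiD_noPocket`).  The single-`d` theorem of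
`M9NoPocketM9` is the case `D = {d}`.  Proof: the fibration of `M9NoPocketFibre`, the
complement identity for `p ~ q` (`conn_pq_compl_assignX`, from `M9NoPocketCompl2`), the
per-representative identity `σ_pq(ρ_x) + σ_pq(ρ^O_x) = G(x) − G(cdual x)` with `G` increasing
and `σ_rs` decreasing on the legal vectors (`M9NoPocketMono`, `M9NoPocketFlipRS`), and Harris on
the self-dual sublattice of legal vectors (`M9NoPocketHarris`).  Own work; std axioms.
-/

namespace Summit.Ventures.PercRepro2

namespace NoPocketSet

open Finset Classical RegionHub OneColourSwitch SideSwitch M9Reduce NoPocket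

variable {V : Type*} {E : Type*}

section Theorem

variable [Fintype V] [DecidableEq V] [Fintype E] [DecidableEq E]

variable {ends : E → Sym2 V}

/-- **The complement identity for `p ~ q`**: `p ~_W q` in the assignment `x` is `p ~_Y q` in
the dual assignment of the outside-flipped representative. -/
theorem conn_pq_compl_assignX {p q r s : V} {D : Finset V} (hnp : NoPocketAt ends D r s)
    (hind : DIndep ends D) (hpD : p ∉ D) (hqD : q ∉ D) (hDr : ∀ d ∈ D, d ≠ r) (hDs : ∀ d ∈ D, d ≠ s) {ρ : Config E} (hρ : ρ ∈ RepD ends p q r s D)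
    {x : Finset (Finset V) × Finset E} (hx : x ∈ L4 ends D r s ρ) :
    Conn ends (OneColourSwitch.compl (assignX ends x ρ)) p q ↔
      Conn ends (assignX ends (cdual ends D r s ρ x) (flipOp ends D r s ρ)) p q := by
  obtain ⟨⟨hT, hF⟩, _⟩ := mem_L4.1 hx
  have hρO := flipOp_mem_RepD hρ
  have hxc : cdual ends D r s ρ x ∈ L4 ends D r s (flipOp ends D r s ρ) := by
    rw [L4_flipOp]; exact cdual_mem_L4 hx
  have hsep := (mem_DSubSet.1 (mem_DSubSet_assignX_of_mem_L4 hnp hind hpD hqD hDr hDs hρ hx)).1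
  have hsepc := (mem_DSubSet.1 (mem_DSubSet_assignX_of_mem_L4 hnp hind hpD hqD hDr hDs hρO hxc)).1
  have hpt : ∀ {e : E}, e ∉ within ends ({r, s} : Set V) →
      OneColourSwitch.compl (assignX ends x ρ) e =
        assignX ends (cdual ends D r s ρ x) (flipOp ends D r s ρ) e :=
    fun he => compl_assignX_eq_off_rs hnp hDr hDs hρ hT hF he
  have hrs_touch : ∀ {ω : Config E} {e : E}, e ∈ within ends ({r, s} : Set V) →
      e ∈ touches ends (K2 ends r s ω) := by
    intro ω e hrs
    obtain ⟨z, hz, w, _, hzw⟩ := hrs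
    refine ⟨z, ?_, w, hzw⟩
    rcases Set.mem_insert_iff.1 hz with rfl | hz'
    · exact r_mem_K2 _ _ _
    · rw [Set.mem_singleton_iff.1 hz']; exact s_mem_K2 _ _ _
  constructor
  · intro hc
    refine conn_of_eqOn_notTouches (H := ({r, s} : Set V))
      (ω := OneColourSwitch.compl (assignX ends x ρ)) (not_mem_M2_of_sep2 hsep).1 ?_ hc
    intro e he
    exact (hpt (fun hrs => he (hrs_touch hrs))).symm
  · intro hc
    refine conn_of_eqOn_notTouches (H := ({r, s} : Set V))
      (ω := assignX ends (cdual ends D r s ρ x) (flipOp ends D r s ρ))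
      (not_mem_K2_of_sep2 hsepc).1 ?_ hc
    intro e he
    exact hpt (fun hrs => he (hrs_touch hrs))

/-- The `p ~_Y q` indicator of an assignment. -/
noncomputable def Yc (ends : E → Sym2 V) (p q : V) (ρ : Config E)
    (x : Finset (Finset V) × Finset E) : ℤ :=
  if Conn ends (assignX ends x ρ) p q then 1 else 0

/-- The increasing function of the Harris step: `Yc_ρ + Yc_{ρ^O}`. -/
noncomputable def Gfun (ends : E → Sym2 V) (p q r s : V) (D : Finset V) (ρ : Config E)
    (x : Finset (Finset V) × Finset E) : ℤ :=
  Yc ends p q ρ x + Yc ends p q (flipOp ends D r s ρ) x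

/-- **The per-representative identity**: `σ_pq(ρ_x) + σ_pq(ρ^O_x) = G(x) − G(cdual x)`. -/
lemma sigma_pq_add_flipOp {p q r s : V} {D : Finset V} (hnp : NoPocketAt ends D r s)
    (hind : DIndep ends D) (hpD : p ∉ D) (hqD : q ∉ D) (hDr : ∀ d ∈ D, d ≠ r) (hDs : ∀ d ∈ D, d ≠ s) {ρ : Config E} (hρ : ρ ∈ RepD ends p q r s D)
    {x : Finset (Finset V) × Finset E} (hx : x ∈ L4 ends D r s ρ) :
    sigma ends (assignX ends x ρ) p q + sigma ends (assignX ends x (flipOp ends D r s ρ)) p q =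
      Gfun ends p q r s D ρ x - Gfun ends p q r s D ρ (cdual ends D r s ρ x) := by
  have hρO := flipOp_mem_RepD hρ
  have hxO : x ∈ L4 ends D r s (flipOp ends D r s ρ) := by rw [L4_flipOp]; exact hx
  have e1 := conn_pq_compl_assignX hnp hind hpD hqD hDr hDs hρ hx
  have e2 := conn_pq_compl_assignX hnp hind hpD hqD hDr hDs hρO hxO
  rw [flipOp_flipOp, cdual_flipOp] at e2
  unfold sigma Gfun Yc
  by_cases hB : Conn ends (OneColourSwitch.compl (assignX ends x ρ)) p q <;>
    by_cases hD : Conn ends (OneColourSwitch.compl (assignX ends x (flipOp ends D r s ρ))) p q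
  · have h1 := e1.1 hB
    have h2 := e2.1 hD
    simp only [hB, hD, h1, h2, if_true]
    ring
  · have h1 := e1.1 hB
    have h2 : ¬ Conn ends (assignX ends (cdual ends D r s ρ x) ρ) p q := fun h => hD (e2.2 h)
    simp only [hB, hD, h1, h2, if_true, if_false]
    ring
  · have h1 : ¬ Conn ends (assignX ends (cdual ends D r s ρ x) (flipOp ends D r s ρ)) p q :=
      fun h => hB (e1.2 h)
    have h2 := e2.1 hD
    simp only [hB, hD, h1, h2, if_true, if_false]
    ring
  · have h1 : ¬ Conn ends (assignX ends (cdual ends D r s ρ x) (flipOp ends D r s ρ)) p q :=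
      fun h => hB (e1.2 h)
    have h2 : ¬ Conn ends (assignX ends (cdual ends D r s ρ x) ρ) p q := fun h => hD (e2.2 h)
    simp only [hB, hD, h1, h2, if_false]
    ring

/-- The outside flip maps representatives to representatives, as a bijection. -/
lemma flipOp_bij {p q r s : V} {D : Finset V} :
    ∀ ρ ∈ RepD ends p q r s D, flipOp ends D r s ρ ∈ RepD ends p q r s D :=
  fun _ hρ => flipOp_mem_RepD hρ

/-- **The main inequality on the no-pocket class**: for every finite marked multigraph and
every non-mark `d` whose neighbours other than `r, s` are adjacent to `r` or `s`,
`Σ_{ω ∈ Sep, D(ω) ⊆ {d}} σ_pq · σ_rs ≤ 0`. -/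
theorem dSignSum_nonpos_of_noPocketSet {p q r s : V} {D : Finset V} (hnp : NoPocketAt ends D r s)
    (hind : DIndep ends D) (hpD : p ∉ D) (hqD : q ∉ D) (hDr : ∀ d ∈ D, d ≠ r) (hDs : ∀ d ∈ D, d ≠ s) : dSignSum ends p q r s D ≤ 0 := by
  have hsum : dSignSum ends p q r s D =
      ∑ ρ ∈ RepD ends p q r s D, ∑ x ∈ L4 ends D r s ρ,
        sigma ends (assignX ends x ρ) p q * sigma ends (assignX ends x ρ) r s := by
    rw [dSignSum, ← Finset.sum_filter]
    rw [← sum_dSub_eq_sum_repD_L4 hnp hind hpD hqD hDr hDs (fun ω => sigma ends ω p q * sigma ends ω r s)]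
    refine Finset.sum_congr ?_ (fun _ _ => rfl)
    ext ω
    simp [DSubSet]
  have hsumO : (∑ ρ ∈ RepD ends p q r s D, ∑ x ∈ L4 ends D r s ρ,
        sigma ends (assignX ends x ρ) p q * sigma ends (assignX ends x ρ) r s) =
      ∑ ρ ∈ RepD ends p q r s D, ∑ x ∈ L4 ends D r s ρ,
        sigma ends (assignX ends x (flipOp ends D r s ρ)) p q *
          sigma ends (assignX ends x ρ) r s := by
    symm
    refine Finset.sum_nbij' (fun ρ => flipOp ends D r s ρ) (fun ρ => flipOp ends D r s ρ)
      flipOp_bij flipOp_bij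
      (fun ρ _ => flipOp_flipOp ρ) (fun ρ _ => flipOp_flipOp ρ) ?_
    intro ρ hρ
    rw [L4_flipOp]
    refine Finset.sum_congr rfl (fun x hx => ?_)
    rw [sigma_rs_assignX_flipOp hnp hind hDr hDs hρ hx]
  have hkey : ∀ ρ ∈ RepD ends p q r s D,
      ∑ x ∈ L4 ends D r s ρ,
        (sigma ends (assignX ends x ρ) p q + sigma ends (assignX ends x (flipOp ends D r s ρ)) p q) *
          sigma ends (assignX ends x ρ) r s ≤ 0 := by
    intro ρ hρ
    have hρO := flipOp_mem_RepD hρ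
    have hGmono : ∀ x ∈ L4 ends D r s ρ, ∀ x' ∈ L4 ends D r s ρ, x ≤ x' →
        Gfun ends p q r s D ρ x ≤ Gfun ends p q r s D ρ x' := by
      intro x hx x' hx' hxx'
      have hxO : x ∈ L4 ends D r s (flipOp ends D r s ρ) := by rw [L4_flipOp]; exact hx
      have hx'O : x' ∈ L4 ends D r s (flipOp ends D r s ρ) := by rw [L4_flipOp]; exact hx'
      unfold Gfun Yc
      exact add_le_add (ite_le_ite_of_imp (conn_pq_assignX_mono hnp hind hpD hqD hDr hDs hρ hxx' hx hx'))
        (ite_le_ite_of_imp (conn_pq_assignX_mono hnp hind hpD hqD hDr hDs hρO hxx' hxO hx'O))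
    have hHanti : ∀ x ∈ L4 ends D r s ρ, ∀ x' ∈ L4 ends D r s ρ, x ≤ x' →
        sigma ends (assignX ends x' ρ) r s ≤ sigma ends (assignX ends x ρ) r s := by
      intro x hx x' hx' hxx'
      unfold sigma
      exact sub_le_sub (ite_le_ite_of_imp (conn_rs_assignX_anti hnp hind hpD hqD hDr hDs hρ hxx' hx hx'))
        (ite_le_ite_of_imp (conn_rs_compl_assignX_mono hnp hind hpD hqD hDr hDs hρ hxx' hx hx'))
    have hH := NoPocket.sum_sub_dual_mul_nonpos_of_sublattice''
      (L := L4 ends D r s ρ) (c := cdual ends D r s ρ)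
      (fun x hx => cdual_cdual ((mem_L4.1 hx).1.1) ((mem_L4.1 hx).1.2)) (cdual_antitone ρ)
      (fun _ _ hx hx' => L4_sup_mem hx hx') (fun _ _ hx hx' => L4_inf_mem hx hx')
      (fun _ hx => cdual_mem_L4 hx) (G := Gfun ends p q r s D ρ)
      (H := fun x => sigma ends (assignX ends x ρ) r s) hGmono hHanti
    refine le_trans (le_of_eq ?_) hH
    refine Finset.sum_congr rfl (fun x hx => ?_)
    rw [sigma_pq_add_flipOp hnp hind hpD hqD hDr hDs hρ hx]
  have htwice : 2 * dSignSum ends p q r s D ≤ 0 := by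
    calc 2 * dSignSum ends p q r s D
        = dSignSum ends p q r s D + dSignSum ends p q r s D := by ring
      _ = (∑ ρ ∈ RepD ends p q r s D, ∑ x ∈ L4 ends D r s ρ,
            sigma ends (assignX ends x ρ) p q * sigma ends (assignX ends x ρ) r s) +
          ∑ ρ ∈ RepD ends p q r s D, ∑ x ∈ L4 ends D r s ρ,
            sigma ends (assignX ends x (flipOp ends D r s ρ)) p q *
              sigma ends (assignX ends x ρ) r s := by
          rw [← hsumO, ← hsum]
      _ = ∑ ρ ∈ RepD ends p q r s D, ∑ x ∈ L4 ends D r s ρ,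
            (sigma ends (assignX ends x ρ) p q +
              sigma ends (assignX ends x (flipOp ends D r s ρ)) p q) *
              sigma ends (assignX ends x ρ) r s := by
          rw [← Finset.sum_add_distrib]
          refine Finset.sum_congr rfl (fun ρ _ => ?_)
          rw [← Finset.sum_add_distrib]
          refine Finset.sum_congr rfl (fun x _ => ?_)
          ring
      _ ≤ 0 := Finset.sum_nonpos (fun ρ hρ => hkey ρ hρ)
  linarith

omit [Fintype V] [DecidableEq V] [Fintype E] [DecidableEq E] in
/-- `DSub` holds for every `Sep`-colouring when every non-mark outside `D` is adjacent to
`p` or `q`. -/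
lemma DSub_of_adj {p q r s : V} {D : Finset V}
    (hadj : ∀ x, Nonmark p q r s x → x ∉ D → ∃ e, ends e = s(x, p) ∨ ends e = s(x, q))
    {ω : Config E} (h : sep2 ends p q r s ω) : DSub ends r s D ω := by
  intro x hDr hDs hd hK hM
  obtain ⟨e, he⟩ := hadj x (nonmark_of_mem_U2 h (Or.inl hK) hDr hDs) hd
  obtain ⟨⟨hpK, hqK⟩, ⟨hpM, hqM⟩⟩ := sep2_iff.1 h
  cases hc : ω e
  · rcases he with he | he
    · exact hpM (mem_M2_of_closed hM hc he)
    · exact hqM (mem_M2_of_closed hM hc he)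
  · rcases he with he | he
    · exact hpK (mem_K2_of_open hK hc he)
    · exact hqK (mem_K2_of_open hK hc he)

/-- **`m9` on the single-`d` class without a pocket**: if every non-mark other than `d` is
adjacent to `p` or `q`, and every neighbour of `d` other than `r, s` is adjacent to `r` or `s`,
then `Σ_{Sep} σ_pq · σ_rs ≤ 0`. -/
theorem m9SignSum_nonpos_of_multiD_noPocket {p q r s : V} {D : Finset V}
    (hnp : NoPocketAt ends D r s) (hind : DIndep ends D)
    (hadj : ∀ x, Nonmark p q r s x → x ∉ D → ∃ e, ends e = s(x, p) ∨ ends e = s(x, q))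
    (hpD : p ∉ D) (hqD : q ∉ D) (hDr : ∀ d ∈ D, d ≠ r) (hDs : ∀ d ∈ D, d ≠ s) :
    m9SignSum ends p q r s ≤ 0 := by
  have h : m9SignSum ends p q r s = dSignSum ends p q r s D := by
    unfold m9SignSum dSignSum
    refine Finset.sum_congr rfl (fun ω _ => ?_)
    by_cases hsep : sep2 ends p q r s ω
    · simp [hsep, DSub_of_adj hadj hsep]
    · simp [hsep]
  rw [h]
  exact dSignSum_nonpos_of_noPocketSet hnp hind hpD hqD hDr hDs

end Theorem

end NoPocketSet

end Summit.Ventures.PercRepro2
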